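import Summits.QuantumFields.YangMills.Theorems.UnitScaleTiltProp7H46Reality
import Summits.QuantumFields.YangMills.Theorems.UnitScaleTiltProp7DeltaEtaStarReality
import Summits.QuantumFields.YangMills.Theorems.UnitScaleTiltProp7SectET3SymmetryRowsT3
import Literature.MathematicalPhysics.QuantumFieldTheory.Balaban1983to89.B9Eq3119DeltaPiCarrier
import HarnessLib

/-!
# Route `UnitScaleTilt`, crux K1 child «MinimiserStabilityRegPr» (stmt-QuantumFields-19200), stub `stub_existenceMinimalOrbit` (EX), route (α) —
# (Δ-1) «HDELTA-MEMBER»: **PRINT'S `Δ_π(U₀)` (3.119) AT THE MEMBER IS SYMMETRIC FOR THE BILINEAR TRACE PAIRING (27)**, and hence the `hΔ` binder of the (63) certificate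
# `pair27_W80(_zpow)` HOLDS for the (W-X′) letter of record `Δ̃π := currentCLM frobEquiv lev₁ Dc (DeltaPiSlot F n K h c₀ cB a U₀)` (EX namer ★w2-19200 g6, 2026-08-28T19:50:28Z (G20))

Cell `ym3-torus`, width seat `ym3-torus-px14` (gen 2; explicit-unit width hand; LOCATE «WF-LETTERS» `ym3-torus-px14/LOCATE-WF-LETTERS-px14g2.md`).  THEOREMS ONLY (0 `def`, 0 `sorry`).
`--supports stmt-QuantumFields-19200 --as helper`, count-neutral.  YM₃ on T³ is a ladder rung (R3), not the Clay problem; nothing here claims the stub, the crux, d = 4 or the mass gap.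

THE PRINT.  [Balaban1985BackgroundPropagators] (3.118)–(3.119) p. 419: *«⟨A, Δ_πA⟩ = ⟨A − DG′RD*A, Δ(A − DG′RD*A)⟩»* — `Δ_π` IS DEFINED BY A QUADRATIC FORM, so its polarisation
for the bilinear pairing (3.11)∕[Balaban1985Variational] (27) `⟨A, B⟩ = Σ_b η^d tr A(b)B(b)` is symmetric: `⟨Δ_πY, Z⟩ = ⟨Δ_πZ, Y⟩`; [Balaban1985Variational] (80) p. 290 uses exactly this
(the `½⟨HD(A′), Δ_π HD(A′)⟩` term), and `B11Eq80Current.pair27_W80` ∕ ✓p661650 `B11Eq80CurrentZpow.pair27_W80_zpow` carry it as the DISPLAYED binder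
`hΔ : ∀ Y Z, pair27 τ (Δπ Y) (flat115 Z) = pair27 τ (Δπ Z) (flat115 Y)`.

WHY ∕ HOW (LOCATE «WF-LETTERS» §3 (Δ-1); the namer's (W-X′) ruling fixes `Δ̃π := currentCLM frobEquiv … (DeltaPiSlot … U₀)`, lit's lattice-generic (115)→(−3) reader
✓`B9Eq3119DeltaPiCarrier.currentCLM` applied to the cell's Hilbert-level letter ✓`Prop7SectET3DeltaPi.DeltaPiSlot = gaugeCorr† ∘ DeltaEta ∘ gaugeCorr`).  Lit's
✓`pairSum_currentCLM_comm φ τ lev₁ Dc (hτ₂) (hT)` reduces `hΔ` to ONE member row `hT : ∀ x y, tpair φ τ x (T y) = tpair φ τ y (T x)` — symmetry of `T := DeltaPiSlot U₀` for lit's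
BILINEAR trace pairing ✓`B9Eq311TracePairing.tpair`.  That row follows from three LANDED facts about the cell's letters: (i) `Δ_π(U₀) = P†Δ^ηP` is Hilbert-symmetric
(✓`Prop7SectET3DeltaOne.DeltaPiSlot_isSymmetric`, from ✓`DeltaEta_isSymmetric`); (ii) `Δ_π(U₀)` commutes with the conjugation `σ = toL2 ∘ star ∘ toL2⁻¹` (✓`Prop7H46Reality.DeltaPiSlot_star_comm`,
its `hΔη` binder discharged by ✓`Prop7DeltaEtaStarReality.DeltaEta_star_comm`, its `QTwS` star-row `hQ` DISPLAYED — or discharged on `RegPr` by ✓`Prop7QTwSRealitySectors`); (iii) `σ` is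
an anti-unitary involution (✓`Prop7SectET3HilbertLettersReality.inner_toL2_star`, `toL2_star_star`) and lit's reading `tpair φ τ f g = ⟪f⋆, g⟫` (✓`tpair_eq_inner_starW`) with `f⋆ = σ f` at
`φ := frobEquiv` (§1).  Then `(x, Δ_π y) = ⟪σx, Δ_π y⟫ = ⟪Δ_π σx, y⟫ = ⟪σ Δ_π x, y⟫ = ⟪σ Δ_π x, σσy⟫ = ⟪σy, Δ_π x⟫ = (y, Δ_π x)`.

WHAT IS PROVED (sorry-free; no definition; the trace functional `τ` a LETTER with the cell's norming row `hφ : ⟪frobEquiv⁻¹X, frobEquiv⁻¹Y⟫ = τ(X*Y)` — discharged for `τ := tr` by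
✓`Prop7SectET3HilbertLetters.inner_frobEquiv_symm`, one `rfl`).
* §1 `starW_frobEquiv_eq` — lit's fibrewise involution `starW frobEquiv` on the member's `L²` IS the cell's conjugation `f ↦ toL2 (star (toL2⁻¹ f))`.
* §2 ★ **`tpair_DeltaPiSlot_comm`** — `(x, Δ_π(U₀) y) = (y, Δ_π(U₀) x)` for lit's bilinear pairing, given the `QTwS` star-row `hQ`; ★ `tpair_DeltaPiSlot_comm_of_regPr` — the same on
  `RegPr F n K ε₀ U₀` in the windows `10⁹L²e ≤ 1`, `10¹²L³ε₀ ≤ 1` modulo the single centre row (Q-b)ʳ `hscR` (✓`QTwS_star_comm_of_regPr_of_realScalar`).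
* §3 ★★ **`hΔ_currentCLM_DeltaPiSlot`** — THE `hΔ` BINDER OF `pair27_W80_zpow` VERBATIM at `Δπ := currentCLM frobEquiv lev₁ Dc (DeltaPiSlot F n K h c₀ cB a U₀)`, for EVERY level
  profile `lev₀ lev₁`, derivative letter `Dc` and scales `L η` of the (115) carrier (tracial `τ`, norming `hφ`, `hQ`); ★★ `hΔ_currentCLM_DeltaPiSlot_member` — the same at the EX knit's
  member indices `lev ≡ K − n`, `Dc := nabla115 η (bgOfCfg F K U₀)`, `L := F.L`, `η := (F.L)⁻¹^(K−n)` (the (W-X′) `Δ̃π` ON THE NOSE); ★★ `hΔ_currentCLM_DeltaPiSlot_of_regPr` (on `RegPr`, modulo `hscR`).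
HONEST SCOPE.  Linear algebra over landed letters; no estimate; no row of [Balaban1985BackgroundPropagators] Thm 3.11 (positivity) is touched; `hQ`∕`hscR` stay displayed exactly as in
✓`Prop7H46Reality`∕✓`Prop7DeltaEtaStarReality`; the stub is not closed.

References: T. Bałaban, CMP 99 (1985) 389–434 [Balaban1985BackgroundPropagators] ((3.11) p.392, (3.118)–(3.120) p.419); CMP 102 (1985) 277–309 [Balaban1985Variational] ((27) p.282,
(80) p.290, (63) p.287).
-/

set_option autoImplicit false

noncomputable section

open scoped InnerProductSpace ComplexConjugate Matrix.Norms.L2Operator BigOperators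

namespace Summit.QuantumFields.YangMills.Theorems.Prop7SectET3DeltaPiTpairSymm

open Literature.MathematicalPhysics.QuantumFieldTheory.Balaban1983to89
open Literature.MathematicalPhysics.QuantumFieldTheory.Balaban1983to89.T3ContinuumYM3Torus
open Literature.MathematicalPhysics.QuantumFieldTheory.Balaban1983to89.B9Eq311TracePairing (tpair starW equiv_starW tpair_eq_inner_starW)
open Literature.MathematicalPhysics.QuantumFieldTheory.Balaban1983to89.B9Eq3119DeltaPiCarrier (currentCLM pairSum_currentCLM_comm)
open Literature.MathematicalPhysics.QuantumFieldTheory.Balaban1983to89.B11Eq90Transpose (pair27 pair27_eq_sum)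
open Literature.MathematicalPhysics.QuantumFieldTheory.Balaban1983to89.B11Eq90V0primeCurrent (flat115)
open T3PrintedRegularMinimiser (RegPr)
open B9SectCLatticeCarrier (Bond)
open B9Eq311L2Pairing (WL2)
open B11Eq103H1Complex (BondL2K)
open B11Eq115Space (NegSup NegSize Space115 levWeight)
open B11Eq111FrakG (nabla115)
open Summit.QuantumFields.YangMills.Theorems.Prop7SectET3Transport (periodsT3 bondEquiv bgOfCfg)
open Summit.QuantumFields.YangMills.Theorems.Prop7SectET3HilbertLetters (W₂ frobEquiv toL2 toL2_apply toL2_symm_apply)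
open Summit.QuantumFields.YangMills.Theorems.Prop7SectET3HilbertLettersReality (inner_toL2_star toL2_star_star)
open Summit.QuantumFields.YangMills.Theorems.Prop7SectET3WilsonHessian (DeltaEta)
open Summit.QuantumFields.YangMills.Theorems.Prop7SectET3DeltaPi (gaugeCorr DeltaPi DeltaPiSlot DeltaPiSlot_apply)
open Summit.QuantumFields.YangMills.Theorems.Prop7H46Reality (DeltaPiSlot_star_comm)
open Summit.QuantumFields.YangMills.Theorems.Prop7DeltaEtaStarReality (DeltaEta_star_comm)
open Summit.QuantumFields.YangMills.Theorems.Prop7QTwSRealitySectors (QTwS_star_comm_of_regPr_of_realScalar)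
open Summit.QuantumFields.YangMills.Theorems.Prop7SymAvgTwSym (QTwS)

variable (F : T3Family) (n K : ℕ) (h : n ≤ K) (c₀ cB a : ℝ) [Fact (0 < c₀)] [Fact (0 < cB)]

/-! ## §1 Lit's fibrewise involution at `φ := frobEquiv` is the cell's conjugation `σ = toL2 ∘ star ∘ toL2⁻¹` -/

omit [Fact (0 < c₀)] in
/-- **`f⋆ = σ f`**: lit's `B9Eq311TracePairing.starW frobEquiv f` (bondwise `φ⁻¹ ∘ star ∘ φ`) IS the cell's conjugation `toL2 (star (toL2⁻¹ f))` of ✓`Prop7SectET3HilbertLettersReality`.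
[cite: Balaban1985BackgroundPropagators, (3.11) p.392] -/
theorem starW_frobEquiv_eq (f : BondL2K ℂ 3 (periodsT3 F K) c₀ W₂) :
    starW frobEquiv f = toL2 F K c₀ (star ((toL2 F K c₀).symm f)) := by
  apply (WL2.equiv ℂ (fun _ : Bond 3 (periodsT3 F K) => c₀) W₂).injective
  funext p
  rw [equiv_starW, toL2_apply, Pi.star_apply, toL2_symm_apply, Equiv.apply_symm_apply]

/-! ## §2 ★ `Δ_π(U₀)` is symmetric for lit's BILINEAR trace pairing -/

/-- ★ **`(x, Δ_π(U₀) y) = (y, Δ_π(U₀) x)`** for lit's bilinear trace pairing `tpair frobEquiv τ` ((3.11)∕(27) without conjugation), for any trace letter `τ` with the cell's norming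
`⟪frobEquiv⁻¹X, frobEquiv⁻¹Y⟫ = τ(X*Y)`, given the `QTwS` star-row `hQ` (as in ✓`Prop7H46Reality`): symmetric (✓`Prop7SectET3DeltaOne.DeltaPiSlot_isSymmetric`) + real (✓`DeltaPiSlot_star_comm` ∘ ✓`DeltaEta_star_comm`) + `σ` anti-unitary.
[cite: Balaban1985BackgroundPropagators, (3.118)–(3.119) p.419, (3.11) p.392] -/
theorem tpair_DeltaPiSlot_comm (τ : Matrix (Fin 2) (Fin 2) ℂ →ₗ[ℂ] ℂ) (hφ : ∀ X Y : Matrix (Fin 2) (Fin 2) ℂ, ⟪frobEquiv.symm X, frobEquiv.symm Y⟫_ℂ = τ (star X * Y))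
    (U₀ : GaugeField (F.P K) 0 (Matrix.specialUnitaryGroup (Fin 2) ℂ))
    (hQ : ∀ A : PBond (F.P K) 0 → Matrix (Fin 2) (Fin 2) ℂ, QTwS F n K h U₀ (star A) = star (QTwS F n K h U₀ A))
    (x y : BondL2K ℂ 3 (periodsT3 F K) c₀ W₂) :
    tpair frobEquiv τ x (DeltaPiSlot F n K h c₀ cB a U₀ y) = tpair frobEquiv τ y (DeltaPiSlot F n K h c₀ cB a U₀ x) := by
  have hsymm := Prop7SectET3DeltaOne.DeltaPiSlot_isSymmetric (F := F) (n := n) (K := K) (h := h) (c₀ := c₀) (cB := cB) (a := a) U₀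
  have hreal := DeltaPiSlot_star_comm F n K h c₀ cB a U₀ hQ (DeltaEta_star_comm U₀)
  have ex : ∀ f g : BondL2K ℂ 3 (periodsT3 F K) c₀ W₂, tpair frobEquiv τ f g = ⟪toL2 F K c₀ (star ((toL2 F K c₀).symm f)), g⟫_ℂ := fun f g => by
    rw [tpair_eq_inner_starW frobEquiv τ hφ f g, starW_frobEquiv_eq F K c₀ f]
  rw [ex, ex]
  calc ⟪toL2 F K c₀ (star ((toL2 F K c₀).symm x)), DeltaPiSlot F n K h c₀ cB a U₀ y⟫_ℂ
      = ⟪DeltaPiSlot F n K h c₀ cB a U₀ (toL2 F K c₀ (star ((toL2 F K c₀).symm x))), y⟫_ℂ := (hsymm _ _).symm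
    _ = ⟪toL2 F K c₀ (star ((toL2 F K c₀).symm (DeltaPiSlot F n K h c₀ cB a U₀ x))), y⟫_ℂ := by rw [hreal]
    _ = ⟪toL2 F K c₀ (star ((toL2 F K c₀).symm (DeltaPiSlot F n K h c₀ cB a U₀ x))),
          toL2 F K c₀ (star ((toL2 F K c₀).symm (toL2 F K c₀ (star ((toL2 F K c₀).symm y)))))⟫_ℂ := by rw [toL2_star_star]
    _ = ⟪toL2 F K c₀ (star ((toL2 F K c₀).symm y)), DeltaPiSlot F n K h c₀ cB a U₀ x⟫_ℂ := inner_toL2_star _ _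

/-- ★ **THE SAME ON THE PRINTED-REGULAR CLASS** `RegPr F n K ε₀ U₀` in the windows `10⁹L²e ≤ 1`, `10¹²L³ε₀ ≤ 1`, MODULO THE SINGLE CENTRE ROW (Q-b)ʳ `hscR` («`QTwS U₀` maps real scalar fields to real
scalar fields»): `hQ` discharged by ✓`Prop7QTwSRealitySectors.QTwS_star_comm_of_regPr_of_realScalar`. [cite: Balaban1985BackgroundPropagators, (3.119) p.419, (3.14) p.393] -/
theorem tpair_DeltaPiSlot_comm_of_regPr [Fact (0 < (F.L : ℝ))] [Fact (0 < ((F.L : ℝ)⁻¹) ^ (K - n))]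
    (τ : Matrix (Fin 2) (Fin 2) ℂ →ₗ[ℂ] ℂ) (hφ : ∀ X Y : Matrix (Fin 2) (Fin 2) ℂ, ⟪frobEquiv.symm X, frobEquiv.symm Y⟫_ℂ = τ (star X * Y))
    {ε₀ e : ℝ} (hε₀ : 0 < ε₀) (he : 0 < e) (hWe : 10 ^ 9 * (F.L : ℝ) ^ 2 * e ≤ 1) (hWε : 10 ^ 12 * (F.L : ℝ) ^ 3 * ε₀ ≤ 1)
    (U₀ : GaugeField (F.P K) 0 (Matrix.specialUnitaryGroup (Fin 2) ℂ)) (hreg : RegPr F n K ε₀ U₀)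
    (hscR : ∀ r : PBond (F.P K) 0 → ℝ, ∃ s : PBond (F.P n) 0 → ℝ,
      QTwS F n K h U₀ (fun b => ((r b : ℝ) : ℂ) • (1 : Matrix (Fin 2) (Fin 2) ℂ)) = fun c => ((s c : ℝ) : ℂ) • (1 : Matrix (Fin 2) (Fin 2) ℂ))
    (x y : BondL2K ℂ 3 (periodsT3 F K) c₀ W₂) :
    tpair frobEquiv τ x (DeltaPiSlot F n K h c₀ cB a U₀ y) = tpair frobEquiv τ y (DeltaPiSlot F n K h c₀ cB a U₀ x) :=
  tpair_DeltaPiSlot_comm F n K h c₀ cB a τ hφ U₀ (QTwS_star_comm_of_regPr_of_realScalar F h hε₀ he hWe hWε U₀ hreg hscR) x y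

/-! ## §3 ★★ The `hΔ` binder of the (63) certificate for `Δ̃π := currentCLM frobEquiv lev₁ Dc (DeltaPiSlot … U₀)` -/

section HDelta

variable {L η : ℝ} [Fact (0 < L)] [Fact (0 < η)] {lev₀ : Bond 3 (periodsT3 F K) → ℕ} {κ' : Type*} [Fintype κ']
  (lev₁ : κ' → ℕ) (Dc : (Bond 3 (periodsT3 F K) → Matrix (Fin 2) (Fin 2) ℂ) →ₗ[ℂ] (κ' → Matrix (Fin 2) (Fin 2) ℂ))

/-- ★★ **THE `hΔ` BINDER OF `pair27_W80`∕✓`pair27_W80_zpow` VERBATIM** at `Δπ := currentCLM frobEquiv lev₁ Dc (DeltaPiSlot F n K h c₀ cB a U₀)` — lit's (115)→(−3) reading of the cell's `Δ_π(U₀)`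
— for every level profile, derivative letter and scale of the (115) carrier over the member lattice: `pair27 τ (Δπ Y) (flat115 Z) = pair27 τ (Δπ Z) (flat115 Y)` (tracial `τ` with the norming `hφ`, star-row
`hQ`).  Proof: lit's ✓`pairSum_currentCLM_comm` + §2. [cite: Balaban1985Variational, (27) p.282, (80) p.290, (63) p.287; Balaban1985BackgroundPropagators, (3.119) p.419] -/
theorem hΔ_currentCLM_DeltaPiSlot (τ : Matrix (Fin 2) (Fin 2) ℂ →L[ℂ] ℂ) (hτ₂ : ∀ X Y : Matrix (Fin 2) (Fin 2) ℂ, τ (X * Y) = τ (Y * X))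
    (hφ : ∀ X Y : Matrix (Fin 2) (Fin 2) ℂ, ⟪frobEquiv.symm X, frobEquiv.symm Y⟫_ℂ = τ (star X * Y))
    (U₀ : GaugeField (F.P K) 0 (Matrix.specialUnitaryGroup (Fin 2) ℂ))
    (hQ : ∀ A : PBond (F.P K) 0 → Matrix (Fin 2) (Fin 2) ℂ, QTwS F n K h U₀ (star A) = star (QTwS F n K h U₀ A))
    (Y Z : Space115 L η lev₀ lev₁ Dc) :
    pair27 τ (currentCLM frobEquiv lev₁ Dc (DeltaPiSlot F n K h c₀ cB a U₀) Y) (flat115 Z)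
      = pair27 τ (currentCLM frobEquiv lev₁ Dc (DeltaPiSlot F n K h c₀ cB a U₀) Z) (flat115 Y) := by
  rw [pair27_eq_sum, pair27_eq_sum]
  exact pairSum_currentCLM_comm frobEquiv (τ : Matrix (Fin 2) (Fin 2) ℂ →ₗ[ℂ] ℂ) lev₁ Dc hτ₂
    (tpair_DeltaPiSlot_comm F n K h c₀ cB a (τ : Matrix (Fin 2) (Fin 2) ℂ →ₗ[ℂ] ℂ) hφ U₀ hQ) Y Z

/-- ★★ **ON THE PRINTED-REGULAR CLASS, MODULO (Q-b)ʳ `hscR`** (windows `10⁹L²e ≤ 1`, `10¹²L³ε₀ ≤ 1`). [cite: Balaban1985Variational, (80) p.290; Balaban1985BackgroundPropagators, (3.119) p.419, (3.14) p.393] -/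
theorem hΔ_currentCLM_DeltaPiSlot_of_regPr [Fact (0 < (F.L : ℝ))] [Fact (0 < ((F.L : ℝ)⁻¹) ^ (K - n))]
    (τ : Matrix (Fin 2) (Fin 2) ℂ →L[ℂ] ℂ) (hτ₂ : ∀ X Y : Matrix (Fin 2) (Fin 2) ℂ, τ (X * Y) = τ (Y * X))
    (hφ : ∀ X Y : Matrix (Fin 2) (Fin 2) ℂ, ⟪frobEquiv.symm X, frobEquiv.symm Y⟫_ℂ = τ (star X * Y))
    {ε₀ e : ℝ} (hε₀ : 0 < ε₀) (he : 0 < e) (hWe : 10 ^ 9 * (F.L : ℝ) ^ 2 * e ≤ 1) (hWε : 10 ^ 12 * (F.L : ℝ) ^ 3 * ε₀ ≤ 1)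
    (U₀ : GaugeField (F.P K) 0 (Matrix.specialUnitaryGroup (Fin 2) ℂ)) (hreg : RegPr F n K ε₀ U₀)
    (hscR : ∀ r : PBond (F.P K) 0 → ℝ, ∃ s : PBond (F.P n) 0 → ℝ,
      QTwS F n K h U₀ (fun b => ((r b : ℝ) : ℂ) • (1 : Matrix (Fin 2) (Fin 2) ℂ)) = fun c => ((s c : ℝ) : ℂ) • (1 : Matrix (Fin 2) (Fin 2) ℂ))
    (Y Z : Space115 L η lev₀ lev₁ Dc) :
    pair27 τ (currentCLM frobEquiv lev₁ Dc (DeltaPiSlot F n K h c₀ cB a U₀) Y) (flat115 Z)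
      = pair27 τ (currentCLM frobEquiv lev₁ Dc (DeltaPiSlot F n K h c₀ cB a U₀) Z) (flat115 Y) :=
  hΔ_currentCLM_DeltaPiSlot F n K h c₀ cB a lev₁ Dc τ hτ₂ hφ U₀ (QTwS_star_comm_of_regPr_of_realScalar F h hε₀ he hWe hWε U₀ hreg hscR) Y Z

end HDelta

/-- ★★ **THE (W-X′) LETTER OF RECORD, ON THE NOSE**: `hΔ` for `Δ̃π := currentCLM frobEquiv (fun _ ↦ K − n) (nabla115 η (bgOfCfg F K U₀)) (DeltaPiSlot F n K h c₀ cB a U₀)` at the EX knit's member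
indices (`L := F.L`, `η := (F.L)⁻¹^(K−n)`, `lev ≡ K − n`, `Dc := nabla115 η (bgOfCfg F K U₀)`) — the binder of ✓`pair27_W80_zpow` for S9's instantiated `Wf` (LOCATE «WF-LETTERS» §0).
[cite: Balaban1985Variational, (80) p.290, (63) p.287; Balaban1985BackgroundPropagators, (3.119) p.419] -/
theorem hΔ_currentCLM_DeltaPiSlot_member [Fact (0 < (F.L : ℝ))] [Fact (0 < ((F.L : ℝ)⁻¹) ^ (K - n))]
    (τ : Matrix (Fin 2) (Fin 2) ℂ →L[ℂ] ℂ) (hτ₂ : ∀ X Y : Matrix (Fin 2) (Fin 2) ℂ, τ (X * Y) = τ (Y * X))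
    (hφ : ∀ X Y : Matrix (Fin 2) (Fin 2) ℂ, ⟪frobEquiv.symm X, frobEquiv.symm Y⟫_ℂ = τ (star X * Y))
    (U₀ : GaugeField (F.P K) 0 (Matrix.specialUnitaryGroup (Fin 2) ℂ))
    (hQ : ∀ A : PBond (F.P K) 0 → Matrix (Fin 2) (Fin 2) ℂ, QTwS F n K h U₀ (star A) = star (QTwS F n K h U₀ A))
    (Y Z : Space115 (F.L : ℝ) (((F.L : ℝ)⁻¹) ^ (K - n)) (fun _ : Bond 3 (periodsT3 F K) => K - n)
        (fun _ : Bond 3 (periodsT3 F K) × Fin 3 => K - n) (nabla115 (((F.L : ℝ)⁻¹) ^ (K - n)) (bgOfCfg F K U₀))) :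
    pair27 τ (currentCLM frobEquiv (fun _ : Bond 3 (periodsT3 F K) × Fin 3 => K - n) (nabla115 (((F.L : ℝ)⁻¹) ^ (K - n)) (bgOfCfg F K U₀))
        (DeltaPiSlot F n K h c₀ cB a U₀) Y) (flat115 Z)
      = pair27 τ (currentCLM frobEquiv (fun _ : Bond 3 (periodsT3 F K) × Fin 3 => K - n) (nabla115 (((F.L : ℝ)⁻¹) ^ (K - n)) (bgOfCfg F K U₀))
        (DeltaPiSlot F n K h c₀ cB a U₀) Z) (flat115 Y) :=
  hΔ_currentCLM_DeltaPiSlot F n K h c₀ cB a (fun _ : Bond 3 (periodsT3 F K) × Fin 3 => K - n) (nabla115 (((F.L : ℝ)⁻¹) ^ (K - n)) (bgOfCfg F K U₀))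
    τ hτ₂ hφ U₀ hQ Y Z

end Summit.QuantumFields.YangMills.Theorems.Prop7SectET3DeltaPiTpairSymm

end
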